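import Summits.AnomalousDissipation.AnomalousDissipation.Theses.TwoAndHalfD
import Summits.AnomalousDissipation.AnomalousDissipation.Theorems.TwoAndHalfDTwohalfdNegPlanarIdentification
import Summits.AnomalousDissipation.AnomalousDissipation.Theorems.TwoAndHalfDScalarLiftGlueR
import Summits.AnomalousDissipation.AnomalousDissipation.Theorems.TwoAndHalfDTwohalfdThesisSharedCore
import Summits.AnomalousDissipation.AnomalousDissipation.Theorems.TwoAndHalfDTwohalfdThesisWOfProfileMixer
import Summits.AnomalousDissipation.AnomalousDissipation.Theorems.TwoAndHalfDTwohalfdThesisSubLogKillsW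

/-!
# Crux `TwoAndHalfD.TwohalfdThesis` (stmt-AnomalousDissipation-0206) is DECIDED BY ITS SIBLINGS:
# the unconditional identification certificate (line `Sketch`, lead c4)

Bookkeeping over landed theorems, no new analysis.  The route target `X := TwohalfdThesis` (the zeroth law inside the
`x₃`-invariant class) carries no content of its own any more:

* `twohalfdThesis_iff_scalarAnomalySteadySourceFormal` — **`X ↔ crux #2` (stmt-AnomalousDissipation-0448), with NO
  hypothesis.**  The identification proved on the negative crux's side
  (`TwohalfdNeg.PlanarIdentification.twohalfdThesis_iff_scalarAnomalySteadySourceFormal`, which carries the glue item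
  `ScalarLiftGlueR` as the explicit hypothesis `hG` because no object file of `TwoAndHalfDScalarLiftGlueR` was on the hub
  when it landed) with `hG` DISCHARGED by the landed `Theorems.scalarLiftGlueR_proof` (stmt-14984).  `→` is the
  `x₃`-invariant descent (2-D energy equality, Alexakis–Doering for `L²` data, index shift); `←` the repaired glue chain.
* `scalarAnomalySteadySourceFormal_of_twohalfdThesis`, `twohalfdThesis_of_scalarAnomalySteadySourceFormal` — the two
  directions by name; the second is the CLOSING TEMPLATE of this item: the day crux #2 is proved by some
  `foo : ScalarAnomalySteadySourceFormal`, `twohalfdThesis_of_scalarAnomalySteadySourceFormal foo : TwohalfdThesis`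
  closes stmt-0206.
* `twohalfdNeg_iff_not_scalarAnomalySteadySourceFormal` — **crux #5 (stmt-0211) `↔ ¬` crux #2**, unconditional;
  with the kill shape `TwohalfdNeg.Negative.twohalfdNeg_iff_not_twohalfdThesis` (p74035): `¬X ↔ TwohalfdNeg`, and
  `not_twohalfdThesis_of_twohalfdNeg` is the REFUTING TEMPLATE of this item.
* `releasedMixingWitness_sandwich` — the position of this line's only open stub W `stub_releasedMixingWitness`
  (skeleton `Cruxes/TwohalfdThesis/Lines/Sketch.lean`): `S1' ⇒ W` (the sibling line's kernel `stub_profileMixerRealizable`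
  of stmt-0448, J2 p132866), `W ⇒ X ∧ crux #2` (shared core p96811), and `S6 ⇒ ¬W` (the negative line's kernel
  `stub_subLogStrain` of stmt-0211, J1 p118382) — the three line kernels of the route are totally ordered by implication
  around ONE open dichotomy, crux #2 versus crux #5.
* `twohalfdThesis_decidedBySiblings` — the conjunction, the by-name certificate behind the lead's outcome
  `blocked-on: stmt-AnomalousDissipation-0448` for stmt-0206.

Supports stmt-AnomalousDissipation-0206.
-/

noncomputable section

set_option linter.dupNamespace false

namespace Summit.AnomalousDissipation.AnomalousDissipation.Theorems.TwohalfdThesis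

open MeasureTheory Set Filter Topology
open scoped ENNReal NNReal
open Literature.Analysis.FunctionSpaces Literature.Analysis.FluidPDE
open Summit.AnomalousDissipation.AnomalousDissipation.Theses.TwoAndHalfD
open Summit.AnomalousDissipation.AnomalousDissipation.Theorems.TwohalfdNeg

/-- **`X ↔ crux #2`, unconditionally: `TwohalfdThesis ↔ ScalarAnomalySteadySourceFormal`.**  The planar
identification `PlanarIdentification.twohalfdThesis_iff_scalarAnomalySteadySourceFormal` with its glue hypothesis
`ScalarLiftGlueR` discharged by the landed `Theorems.scalarLiftGlueR_proof`.  `→`: descent of an `x₃`-invariant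
Leray–Hopf witness to a bounded-energy planar Leray–Hopf family plus bounded-variance weak sourced scalars, planar
dissipation `→ 0` (Alexakis–Doering at `L²` data), index shift; `←`: the route's repaired glue chain
`ScalarAnomalySteadySourceFormal → SourcedScalarUnique2D → ScalarLift2halfDR → TwohalfdThesis`. [folklore] -/
theorem twohalfdThesis_iff_scalarAnomalySteadySourceFormal : TwohalfdThesis ↔ ScalarAnomalySteadySourceFormal :=
  PlanarIdentification.twohalfdThesis_iff_scalarAnomalySteadySourceFormal
    Summit.AnomalousDissipation.AnomalousDissipation.Theorems.scalarLiftGlueR_proof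

/-- **`X ⇒ crux #2`** (the route's kill criterion "X ⇒ #2", now a theorem with no hypothesis): every `x₃`-invariant
zeroth-law witness yields a steady-source scalar anomaly over a bounded-energy steadily forced planar Leray–Hopf family. [folklore] -/
theorem scalarAnomalySteadySourceFormal_of_twohalfdThesis (hX : TwohalfdThesis) : ScalarAnomalySteadySourceFormal :=
  twohalfdThesis_iff_scalarAnomalySteadySourceFormal.1 hX

/-- **`crux #2 ⇒ X` — the CLOSING TEMPLATE of stmt-AnomalousDissipation-0206.**  A proof `foo` of
`ScalarAnomalySteadySourceFormal` (stmt-0448) closes the route target by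
`twohalfdThesis_of_scalarAnomalySteadySourceFormal foo`. [folklore] -/
theorem twohalfdThesis_of_scalarAnomalySteadySourceFormal (h2 : ScalarAnomalySteadySourceFormal) : TwohalfdThesis :=
  twohalfdThesis_iff_scalarAnomalySteadySourceFormal.2 h2

/-- **crux #5 `↔ ¬` crux #2, unconditionally: `TwohalfdNeg ↔ ¬ ScalarAnomalySteadySourceFormal`** (the in-class
negation of the zeroth law is exactly the planar no-anomaly law; `PlanarIdentification` with the glue hypothesis
discharged). [folklore] -/
theorem twohalfdNeg_iff_not_scalarAnomalySteadySourceFormal : TwohalfdNeg ↔ ¬ ScalarAnomalySteadySourceFormal :=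
  PlanarIdentification.twohalfdNeg_iff_not_scalarAnomalySteadySourceFormal
    Summit.AnomalousDissipation.AnomalousDissipation.Theorems.scalarLiftGlueR_proof

/-- **crux #5 `⇒ ¬X` — the REFUTING TEMPLATE of stmt-AnomalousDissipation-0206.**  A proof `bar` of `TwohalfdNeg`
(stmt-0211) refutes the route target by `not_twohalfdThesis_of_twohalfdNeg bar` (kill shape
`TwohalfdNeg.Negative.twohalfdNeg_iff_not_twohalfdThesis`, p74035; also `TwohalfdThesis.Negative.not_twohalfdThesis_iff_twohalfdNeg`, p84098). [folklore] -/
theorem not_twohalfdThesis_of_twohalfdNeg (h5 : TwohalfdNeg) : ¬ TwohalfdThesis :=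
  Summit.AnomalousDissipation.AnomalousDissipation.Theorems.TwohalfdNeg.Negative.twohalfdNeg_iff_not_twohalfdThesis.1 h5

/-- **The sandwich of line kernels: `S1' ⇒ W ⇒ (X ∧ crux #2)` and `S6 ⇒ ¬W`.**  `W` = this line's only open stub
`stub_releasedMixingWitness` (its body verbatim); `S1'` = the body of `stub_profileMixerRealizable`, the kernel of the
sibling crux #2's line (stmt-0448); `S6` = the body of `stub_subLogStrain`, the kernel of the negative crux #5's line
(stmt-0211).  All three implications are landed theorems (`stub_releasedMixingWitness_of_profileMixerRealizable` p132866,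
`twohalfdThesis_and_scalarAnomalySteadySourceFormal_of_releasedMixingWitness` p96811,
`stub_releasedMixingWitness_false_of_subLogStrain` p118382); this theorem only lines them up. [folklore] -/
theorem releasedMixingWitness_sandwich :
    -- S1' ⇒ W
    ((∃ (g : UnitAddTorus (Fin 2) → EuclideanSpace ℝ (Fin 2)) (h : UnitAddTorus (Fin 2) → ℝ),
        Torus.IsSmooth g ∧ Torus.IsDivFree g ∧ Torus.HasZeroMean g ∧ Torus.IsSmooth h ∧ Torus.HasZeroMean h ∧
        ∃ (ν : ℕ → ℝ) (v : ℕ → ℝ → UnitAddTorus (Fin 2) → EuclideanSpace ℝ (Fin 2))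
          (p : ℕ → ℝ → UnitAddTorus (Fin 2) → ℝ) (ρm : ℝ → ℝ) (E R L c₀ : ℝ),
          (∀ j, 0 < ν j) ∧ Tendsto ν atTop (𝓝 0) ∧ 0 < L ∧ 0 < c₀ ∧ Antitone ρm ∧ (∀ r, 0 ≤ ρm r) ∧
          (∀ t, 0 ≤ t → ∫ r in (0 : ℝ)..t, ρm r ≤ R) ∧
          (∀ t, L ≤ t → Torus.scalarL2Sq h * ∫ r in L..t, ρm r ≤ c₀ / 2) ∧
          (∀ j, Torus.IsClassicalNSSolutionOn (Set.Ici 0) (ν j) (fun _ => g) (v j) (p j)) ∧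
          (∀ j t, 0 ≤ t → ∫ x, ‖v j t x‖ ^ 2 ≤ E) ∧
          (∀ j (s T' : ℝ), 0 ≤ s → ∀ φ : ℝ → UnitAddTorus (Fin 2) → ℝ,
            Torus.IsClassicalScalarTransportOn (Set.Icc s T') (ν j) (v j) φ → φ s = h →
            ∀ t ∈ Set.Icc s T', Torus.scalarL2Sq (φ t) ≤ ρm (t - s) ^ 2 * Torus.scalarL2Sq h) ∧
          (∀ j (s : ℝ), 0 ≤ s → ∀ θ' : ℝ → UnitAddTorus (Fin 2) → ℝ,
            Torus.IsClassicalScalarTransportForcedOn (Set.Icc s (s + L)) (ν j) (v j) (fun _ => h) θ' →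
            θ' s = (fun _ => (0 : ℝ)) → c₀ ≤ ∫ x, h x * θ' (s + L) x)) →
      (∃ (g : (UnitAddTorus (Fin 2)) → (EuclideanSpace ℝ (Fin 2))) (h : (UnitAddTorus (Fin 2)) → ℝ),
        Torus.IsSmooth g ∧ Torus.IsDivFree g ∧ Torus.HasZeroMean g ∧ Torus.IsSmooth h ∧ Torus.HasZeroMean h ∧
        ∃ (ν : ℕ → ℝ) (v : ℕ → ℝ → (UnitAddTorus (Fin 2)) → (EuclideanSpace ℝ (Fin 2)))
          (p : ℕ → ℝ → (UnitAddTorus (Fin 2)) → ℝ) (φ : ℕ → ℝ → ℝ → (UnitAddTorus (Fin 2)) → ℝ)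
          (Λ : ℝ → ℝ) (E s₀ M ε : ℝ),
          (∀ j, 0 < ν j) ∧ Tendsto ν atTop (𝓝 0) ∧
          (∀ j, Torus.IsClassicalNSSolutionOn (Ici 0) (ν j) (fun _ => g) (v j) (p j)) ∧
          (∀ j t, 0 ≤ t → ∫ x, ‖v j t x‖ ^ 2 ≤ E) ∧
          (∀ j s, 0 ≤ s → Torus.IsClassicalScalarTransportOn (Ici s) (ν j) (v j) (φ j s) ∧ φ j s s = h) ∧
          0 ≤ s₀ ∧ (∀ τ, 0 ≤ Λ τ) ∧ IntegrableOn Λ (Ici 0) ∧ (∫ τ in Ici 0, Λ τ) ≤ M ∧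
          (∀ j s t, s₀ ≤ s → s ≤ t → Torus.scalarL2Sq (φ j s t) ≤ Λ (t - s) ^ 2 * Torus.scalarL2Sq h) ∧
          0 < ε ∧
          (∀ j, ε ≤ liminf (timeMean fun t => ∫ s in (0 : ℝ)..t, ∫ x, h x * φ j s t x) atTop))) ∧
    -- W ⇒ X ∧ crux #2
    ((∃ (g : (UnitAddTorus (Fin 2)) → (EuclideanSpace ℝ (Fin 2))) (h : (UnitAddTorus (Fin 2)) → ℝ),
        Torus.IsSmooth g ∧ Torus.IsDivFree g ∧ Torus.HasZeroMean g ∧ Torus.IsSmooth h ∧ Torus.HasZeroMean h ∧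
        ∃ (ν : ℕ → ℝ) (v : ℕ → ℝ → (UnitAddTorus (Fin 2)) → (EuclideanSpace ℝ (Fin 2)))
          (p : ℕ → ℝ → (UnitAddTorus (Fin 2)) → ℝ) (φ : ℕ → ℝ → ℝ → (UnitAddTorus (Fin 2)) → ℝ)
          (Λ : ℝ → ℝ) (E s₀ M ε : ℝ),
          (∀ j, 0 < ν j) ∧ Tendsto ν atTop (𝓝 0) ∧
          (∀ j, Torus.IsClassicalNSSolutionOn (Ici 0) (ν j) (fun _ => g) (v j) (p j)) ∧
          (∀ j t, 0 ≤ t → ∫ x, ‖v j t x‖ ^ 2 ≤ E) ∧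
          (∀ j s, 0 ≤ s → Torus.IsClassicalScalarTransportOn (Ici s) (ν j) (v j) (φ j s) ∧ φ j s s = h) ∧
          0 ≤ s₀ ∧ (∀ τ, 0 ≤ Λ τ) ∧ IntegrableOn Λ (Ici 0) ∧ (∫ τ in Ici 0, Λ τ) ≤ M ∧
          (∀ j s t, s₀ ≤ s → s ≤ t → Torus.scalarL2Sq (φ j s t) ≤ Λ (t - s) ^ 2 * Torus.scalarL2Sq h) ∧
          0 < ε ∧
          (∀ j, ε ≤ liminf (timeMean fun t => ∫ s in (0 : ℝ)..t, ∫ x, h x * φ j s t x) atTop)) →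
      TwohalfdThesis ∧ ScalarAnomalySteadySourceFormal) ∧
    -- S6 ⇒ ¬W
    ((∀ g : UnitAddTorus (Fin 2) → EuclideanSpace ℝ (Fin 2), Torus.IsSmooth g → Torus.IsDivFree g →
        Torus.HasZeroMean g →
        ∀ (ν : ℕ → ℝ) (v₀ : ℕ → UnitAddTorus (Fin 2) → EuclideanSpace ℝ (Fin 2))
          (v : ℕ → ℝ → UnitAddTorus (Fin 2) → EuclideanSpace ℝ (Fin 2)),
          (∀ j, 0 < ν j) → Tendsto ν atTop (𝓝 0) →
          (∀ j, Torus.IsGlobalLerayHopf (ν j) (fun _ => g) (v₀ j) (v j)) →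
          (∃ E : ℝ, ∀ j, meanEnergy (v j) ≤ E) →
          Tendsto (fun j => longTimeAvgSup (fun t => Real.sqrt (Torus.eGradNormSq (v j t)).toReal) /
            Real.log (ν j)⁻¹) atTop (𝓝 0)) →
      ¬ (∃ (g : (UnitAddTorus (Fin 2)) → (EuclideanSpace ℝ (Fin 2))) (h : (UnitAddTorus (Fin 2)) → ℝ),
          Torus.IsSmooth g ∧ Torus.IsDivFree g ∧ Torus.HasZeroMean g ∧ Torus.IsSmooth h ∧ Torus.HasZeroMean h ∧
          ∃ (ν : ℕ → ℝ) (v : ℕ → ℝ → (UnitAddTorus (Fin 2)) → (EuclideanSpace ℝ (Fin 2)))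
            (p : ℕ → ℝ → (UnitAddTorus (Fin 2)) → ℝ) (φ : ℕ → ℝ → ℝ → (UnitAddTorus (Fin 2)) → ℝ)
            (Λ : ℝ → ℝ) (E s₀ M ε : ℝ),
            (∀ j, 0 < ν j) ∧ Tendsto ν atTop (𝓝 0) ∧
            (∀ j, Torus.IsClassicalNSSolutionOn (Ici 0) (ν j) (fun _ => g) (v j) (p j)) ∧
            (∀ j t, 0 ≤ t → ∫ x, ‖v j t x‖ ^ 2 ≤ E) ∧
            (∀ j s, 0 ≤ s → Torus.IsClassicalScalarTransportOn (Ici s) (ν j) (v j) (φ j s) ∧ φ j s s = h) ∧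
            0 ≤ s₀ ∧ (∀ τ, 0 ≤ Λ τ) ∧ IntegrableOn Λ (Ici 0) ∧ (∫ τ in Ici 0, Λ τ) ≤ M ∧
            (∀ j s t, s₀ ≤ s → s ≤ t → Torus.scalarL2Sq (φ j s t) ≤ Λ (t - s) ^ 2 * Torus.scalarL2Sq h) ∧
            0 < ε ∧
            (∀ j, ε ≤ liminf (timeMean fun t => ∫ s in (0 : ℝ)..t, ∫ x, h x * φ j s t x) atTop))) :=
  ⟨stub_releasedMixingWitness_of_profileMixerRealizable,
    twohalfdThesis_and_scalarAnomalySteadySourceFormal_of_releasedMixingWitness,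
    stub_releasedMixingWitness_false_of_subLogStrain⟩

/-- **stmt-0206 is decided by its siblings** (the certificate behind the lead's `blocked-on: stmt-AnomalousDissipation-0448`):
`X ↔ crux #2`, `¬X ↔ crux #5`, `crux #5 ↔ ¬ crux #2` — every proof or refutation of the route target is, by name, a
proof or refutation of `ScalarAnomalySteadySourceFormal`; nothing in stmt-0206 can move independently of stmt-0448 /
stmt-0211. [folklore] -/
theorem twohalfdThesis_decidedBySiblings :
    (TwohalfdThesis ↔ ScalarAnomalySteadySourceFormal) ∧ (¬ TwohalfdThesis ↔ TwohalfdNeg) ∧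
      (TwohalfdNeg ↔ ¬ ScalarAnomalySteadySourceFormal) :=
  ⟨twohalfdThesis_iff_scalarAnomalySteadySourceFormal,
    Summit.AnomalousDissipation.AnomalousDissipation.Theorems.TwohalfdNeg.Negative.twohalfdNeg_iff_not_twohalfdThesis.symm,
    twohalfdNeg_iff_not_scalarAnomalySteadySourceFormal⟩

/-- **Registered tools stub `stub_siblingReduction`** (stmt-AnomalousDissipation-0206, `ledger workitem stub-add`):
the conjunction `X ↔ crux #2`, `¬X ↔ crux #5`, `crux #5 ↔ ¬ crux #2` — the by-name certificate that the route target
is decided by its two sibling cruxes. [folklore] -/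
theorem stub_siblingReduction :
    (TwohalfdThesis ↔ ScalarAnomalySteadySourceFormal) ∧ (¬ TwohalfdThesis ↔ TwohalfdNeg) ∧ (TwohalfdNeg ↔ ¬ ScalarAnomalySteadySourceFormal) :=
  twohalfdThesis_decidedBySiblings

end Summit.AnomalousDissipation.AnomalousDissipation.Theorems.TwohalfdThesis

end
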